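/-
Copyright (c) 2026 the pub-hodgecm-mathlib formalisation cell (harness21).  Prover seat hodgecm-mathlib-LH4-p11 (g11), req620 Track A «(D-RAM) FOUR-FRAME» squad
(STAGE-1b, row (2) of the piece `f_{T₊}`, the (β₂) road (R-36), the K6 road; K6 desk LH4-p16 (g3) WORD #9 (b) «p11: Q2 THE BOUNDARY SHELL», FILE A (one field):
the conductor-shell character count and the inversion `V ↦ A₀ ∕ V` of a digit shell; SIG `F0/P3c/LH4/LH4-p11/g11/SIG-Q2.v1.LH4p11g11.md`), 2026-09-05.
-/
import Summits.HodgeConjecture.HodgeConjecture.Theorems.F0P3cDyRamOneChartDigitTotals        -- ★ (LH7-p06 (g3), (d″-T)): `filter_level_repr`, `filter_ball_repr`, `card_filter_level_eq`, `card_filter_ball_eq`; brings ★ (LH4-p09) `sum_eq_sum_of_repr`, `card_eq_card_of_repr`, `exists_repr_fixedBall_card`, `v_le_pow_succ_succ_of_fixed_of_v_lt`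
import Summits.HodgeConjecture.HodgeConjecture.Theorems.F0P3cDyRamWindowLabelSumVanishes      -- ★ p864489 (this seat, K6-(g)): `sum_normSign_affine_ballSystem_eq_zero` (the ball engine); brings ★ Lit `WildQuadraticDatumNormSignConductor`
import HarnessLib

/-!
# Crux `H413`, line LH4 «(D-RAM) FOUR-FRAME» — STAGE-1b, row (2), the (β₂) road (R-36), K6-(d″) Q2, FILE A: «THE CONDUCTOR-SHELL COUNT AND THE INVERSION» — over ANY
# complete irredundant system `S` of the fixed conductor shell `|W| = |ϖ_F|^{d−1}` the character `ω(1 + W)` satisfies `(q − 1)·Σ_S ω(1 + W) = −#S` (so the shell splits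
# `(q − 2) : q`), and the inversion `V ↦ A₀ ∕ V` carries the shell filter of a digit system onto such a system

Cell `hodgecm-mathlib` (D-0151), FLOOR 0, crux item H413 = `stmt-HodgeConjecture-24833`, route of record `HCCMUnconditional`; squad F0∕P3c∕LH4; lane
`--supports stmt-HodgeConjecture-24833 --as helper` (count-neutral; pays NO tier-0 row).  THEOREMS ONLY (no `def`, no instance, no notation, no `sorry`, default heartbeats);
★-only imports; states NO law; (β₂) stays a HYPOTHESIS.  ONE-FIELD local arithmetic of the wild ramified quadratic datum `(σ, ϖ; d, tE)` on a complete `E` with finite residue field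
(`q := Nat.card 𝓀[E]`, `F = E^σ`, `|ϖ_F| = |ϖ|²`, `ω = normSign σ`, `U_F(k)` = fixed units `u` with `|u − 1| ≤ |ϖ|^k`); nothing about lattices, no second field.

WHAT (K6 desk LH4-p16 (g3) WORD #9 (b); LH7-p08 (g3) (d″-Q) census 02:14:31Z «BOUNDARY `i = d − 1`: affine regime after the inversion `V ↦ A₀∕V`»).  On the BOUNDARY cell of the live
row's digit line the H-literal's class conjunct reads `ω(1 + A₀∕V) = 1` (FILE B `…RowCellDigitClassBoundary` §1), where `V` runs over the shell `|V| = |ϖ|^{2t}` of the ONE chart's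
digit system `Rd` (σ-fixed integral representatives modulo `|ϖ|^n`: `hRd1 hRd2 hRd3`, ★ p863833 ∕ ★ (d″-T)) and `A₀` is the pulled-back slope (`σA₀ = A₀`, `|A₀| = |ϖ|^{2a}`,
`a = t + (d − 1)`), so that `W := A₀∕V` runs over the CONDUCTOR SHELL `|W| = |ϖ|^{2(d−1)} = |ϖ_F|^{d−1}`.  THIS FILE:
* §0 two `±1` letters of `normSign` and the class-function letter of `W ↦ ω(1 + W)` at any precision `≥ 2d − 1` (★ Lit `normSign_eq_of_near`).
* §1 `mul_sum_normSign_oneAdd_conductorShell` — over ANY complete irredundant system `S` of the fixed conductor shell modulo `|ϖ|^m` (`2d ≤ m`): **`(q − 1)·Σ_{W ∈ S} ω(1 + W) = −#S`**.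
  Mechanism: transfer to the shell filter of an auxiliary unit-ball system (★ `exists_repr_fixedBall_card`, ★ `sum_eq_sum_of_repr`, ★ `card_eq_card_of_repr`); there the ball
  `|W| ≤ |ϖ_F|^{d−1}` is shell ⊔ inner ball `|W| ≤ |ϖ_F|^d` (fixed valuations are even, ★ `v_le_pow_succ_succ_of_fixed_of_v_lt`); the BALL sum vanishes (★ K6-(g) engine
  `sum_normSign_affine_ballSystem_eq_zero` at `α₁ = γ₁ = 1`, `R = |ϖ_F|^{d−1}`: the coset ball `1 + 𝔭_F^{d−1} = U_F(2d−2)` is stable and reaches itself); on the inner ball every term is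
  `1` (★ Lit `normSign_eq_one_of_fixed_of_v_sub_one_le`); and `#shell = (q − 1)·#inner` (★ `card_filter_level_eq`, ★ `card_filter_ball_eq`).  Splits: `two_mul_card_filter_normSign_oneAdd_eq`
  (`2(q−1)·#{ω(1+W) = 1} = (q−2)·#S`) and `…_ne` (`2(q−1)·#{ω(1+W) ≠ 1} = q·#S`).
* §2 `inversion_image_repr` — THE INVERSION: for a unit-ball system `Rd` modulo `|ϖ|^n`, a shell `2t < n`, a fixed `A₀` with `|A₀| = |ϖ|^{2a}`, `t + s = a`, `m + 4t = n + 2a`: the image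
  `(Rd.filter (|V| = |ϖ|^{2t})).image (A₀ ∕ ·)` is a complete irredundant system of the fixed shell `|W| = |ϖ|^{2s}` modulo `|ϖ|^m`, and `A₀ ∕ ·` is injective on the shell filter
  (`|A₀∕V − A₀∕V′|·|V|·|V′| = |A₀|·|V − V′|`).
* §3 HEAD-A `mul_sum_normSign_oneAdd_div_shell` — §2 at `s = d − 1` + §1 on the image + `Finset.sum_image` ∕ `card_image_of_injOn`:
  **`(q − 1)·Σ_{V ∈ Rd.filter (|V| = |ϖ|^{2t})} ω(1 + A₀∕V) = −#(Rd.filter (|V| = |ϖ|^{2t}))`** under `a = t + (d − 1)` and the resolution floor `2d + 4t ≤ n + 2a` (in the top chart of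
  the row, `a = N`, `t = N − d + 1`: `n + 2d ≥ 2N + 4`, implied by (d″-T)'s `2N + 1 ≤ n`); splits `two_mul_card_filter_normSign_oneAdd_div_eq` ∕ `_ne` (`(q − 2) : q`).
WHAT IS NOT CLAIMED: the identification of `ω(1 + A₀∕V) = 1` with the H-class conjunct (FILE B), the inner shells (LH7-p08 (g3) Q1, the class-flipping twist), the diagonal (Q3),
any census identity.
HONEST LABEL.  Count-neutral local arithmetic; nothing printed is asserted; no census law is stated; `HC_CM` is proved only modulo the 7 printed citations (2 remaining named inputs:
hLiu418 = `stmt-HodgeConjecture-24832`, h413 = `stmt-HodgeConjecture-24833`) until rung 0 closes.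
## References
* [Serre1979] J.-P. Serre, *Local Fields*, GTM 67 (1979): Ch. V §3 Prop. 5, Cor. 2–3 pp. 84–86 (norm index two; the conductor of a ramified quadratic extension), Ch. XV §2
  (conductor via `U^{(n)}`), Ch. IV §2 Prop. 6 (the filtration quotients `U^{(n)}∕U^{(n+1)} ≃ 𝓀`).
* [Flicker1998UnitaryFL] Y. Z. Flicker, *Elementary proof of the fundamental lemma for a unitary group*, Canad. J. Math. 50 (1998): Prop. 7 p. 84 (type RamK census by classes and shells).
* [Kottwitz1986BaseChangeUnits] R. E. Kottwitz, *Base change for unit elements of Hecke algebras*, Compositio Math. 60 (1986): §1 pp. 240–241 (cell-by-cell lattice bookkeeping).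
-/

set_option autoImplicit false

noncomputable section

namespace Summit.HodgeConjecture.HodgeConjecture.Cruxes.H413.F0P3cDyRamConductorShellInversionCount

open WithZero Finset
open scoped Valued
open Literature.NumberTheory.Automorphic.UnitaryThreeFourFrame (IsRamifiedQuadraticDatum normSign)
open Literature.NumberTheory.LocalFields.WildQuadraticDatum (v_varpi_pow normSign_eq_of_near normSign_eq_one_of_fixed_of_v_sub_one_le)
open Summit.HodgeConjecture.HodgeConjecture.Cruxes.H413.F0P3cDyRamDiagonalFixedClassSystems (sum_eq_sum_of_repr card_eq_card_of_repr exists_repr_fixedBall_card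
  v_le_pow_succ_succ_of_fixed_of_v_lt)
open Summit.HodgeConjecture.HodgeConjecture.Cruxes.H413.F0P3cDyRamOneChartDigitTotals (filter_level_repr filter_ball_repr card_filter_level_eq card_filter_ball_eq)
open Summit.HodgeConjecture.HodgeConjecture.Cruxes.H413.F0P3cDyRamWindowLabelSumVanishes (sum_normSign_affine_ballSystem_eq_zero)

variable {E : Type} [Field E] [Valued E ℤᵐ⁰] {σ : E →+* E} {ϖ : E} {d tE : ℕ}

/-! ## §0 Letters: `ω` is `±1`-valued; `W ↦ ω(1 + W)` is a class function on the small ball at any precision reaching the conductor -/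

omit [Valued E ℤᵐ⁰] in
/-- `ω = normSign σ` takes the value `−1` wherever it is not `1`. [cite: Serre1979, Ch. V §3 Prop. 5, Cor. 2–3 pp. 84–86] -/
theorem normSign_eq_neg_one_of_ne_one {x : E} (h : normSign σ x ≠ 1) : normSign σ x = -1 := by
  unfold normSign at h ⊢
  by_cases hx : ∃ z : E, z * σ z = x
  · rw [if_pos hx] at h; exact absurd rfl h
  · rw [if_neg hx]

omit [Valued E ℤᵐ⁰] in
/-- **SPLITTING A `±1` SUM**: over a finite set, `Σ ω = #{ω = 1} − #{ω ≠ 1}` and `#{ω = 1} + #{ω ≠ 1} = #S`. [cite: Serre1979, Ch. XV §2] -/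
theorem sum_normSign_eq_card_sub_card (S : Finset E) (f : E → E) :
    ∑ W ∈ S, normSign σ (f W) = ((S.filter fun W => normSign σ (f W) = 1).card : ℤ) - ((S.filter fun W => ¬ normSign σ (f W) = 1).card : ℤ) ∧
      ((S.filter fun W => normSign σ (f W) = 1).card : ℤ) + ((S.filter fun W => ¬ normSign σ (f W) = 1).card : ℤ) = S.card := by
  classical
  refine ⟨?_, by exact_mod_cast card_filter_add_card_filter_not (s := S) (fun W => normSign σ (f W) = 1)⟩
  rw [← sum_filter_add_sum_filter_not S (fun W => normSign σ (f W) = 1)]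
  rw [sum_congr rfl (fun W hW => (mem_filter.1 hW).2), sum_congr rfl (fun W hW => normSign_eq_neg_one_of_ne_one (mem_filter.1 hW).2)]
  simp only [sum_const, nsmul_eq_mul, mul_one, mul_neg, sub_eq_add_neg]

/-- **`W ↦ ω(1 + W)` IS A CLASS FUNCTION** on the fixed ball `|W| < 1` at any precision `|ϖ|^m`, `2d − 1 ≤ m` (★ Lit `normSign_eq_of_near`: `1 + W′ ∈ (1 + W)·U_F(2d−1)`).
[cite: Serre1979, Ch. XV §2] -/
theorem normSign_oneAdd_eq_of_near [CompleteSpace E] (hD : IsRamifiedQuadraticDatum σ ϖ d tE) {m : ℕ} (hm : 2 * d - 1 ≤ m)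
    {W W' : E} (hσW : σ W = W) (hW : Valued.v W < 1) (hσW' : σ W' = W') (hnear : Valued.v (W - W') ≤ Valued.v ϖ ^ m) :
    normSign σ (1 + W) = normSign σ (1 + W') := by
  refine (normSign_eq_of_near hD (g := 1 + W) (g' := 1 + W') (by rw [map_add, map_one, hσW]) (by rw [map_add, map_one, hσW']) ?_ hm ?_).symm
  · rw [Valuation.map_add_eq_of_lt_left _ (by rwa [Valuation.map_one]), Valuation.map_one]
  · rwa [show (1 + W) - (1 + W') = W - W' by ring]

/-! ## §1 The conductor-shell count: `(q − 1)·Σ_S ω(1 + W) = −#S` over ANY representative system of the shell `|W| = |ϖ_F|^{d−1}` -/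

/-- **THE CONDUCTOR-SHELL COUNT.**  Wild ramified quadratic datum `(σ, ϖ; d, tE)` on a complete `E` with finite residue field (`q := Nat.card 𝓀[E]`), `|2| < 1`, `2 ≤ d`; a precision
`m` with `2d ≤ m`; `S` ANY complete irredundant system of representatives modulo `|ϖ|^m` of the fixed CONDUCTOR SHELL `{W : σW = W ∧ |W| = |ϖ|^{2(d−1)}}`.  THEN
**`(q − 1) · Σ_{W ∈ S} ω(1 + W) = −#S`**.  (The ball `1 + 𝔭_F^{d−1} = U_F(2d−2)` sums to `0` — ★ K6-(g) engine —, its inner ball `1 + 𝔭_F^d ⊆ N(E^×)` contributes `+1` per class, and the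
shell has `q − 1` times as many classes as the inner ball.) [cite: Serre1979, Ch. V §3 Prop. 5, Cor. 2–3 pp. 84–86; Ch. XV §2; Ch. IV §2 Prop. 6] [cite: Flicker1998UnitaryFL, Prop. 7 p. 84] -/
theorem mul_sum_normSign_oneAdd_conductorShell [CompleteSpace E] [Finite 𝓀[E]] (hD : IsRamifiedQuadraticDatum σ ϖ d tE) (h2v : Valued.v (2 : E) < 1) (hd : 2 ≤ d)
    {m : ℕ} (hm : 2 * d ≤ m) (S : Finset E) (hS1 : ∀ W ∈ S, σ W = W ∧ Valued.v W = Valued.v ϖ ^ (2 * (d - 1)))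
    (hS2 : ∀ W : E, σ W = W → Valued.v W = Valued.v ϖ ^ (2 * (d - 1)) → ∃ W₀ ∈ S, Valued.v (W - W₀) ≤ Valued.v ϖ ^ m)
    (hS3 : ∀ W ∈ S, ∀ W' ∈ S, Valued.v (W - W') ≤ Valued.v ϖ ^ m → W = W') :
    ((Nat.card 𝓀[E] : ℤ) - 1) * ∑ W ∈ S, normSign σ (1 + W) = -(S.card : ℤ) := by
  classical
  obtain ⟨hσσ, hvσ, hϖ, hfix, hdd, -, -⟩ := id hD
  have hvϖ0 : Valued.v ϖ ≠ 0 := by rw [hϖ]; exact exp_ne_zero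
  have hϖlt : Valued.v ϖ < 1 := by rw [hϖ, ← exp_zero, exp_lt_exp]; norm_num
  have hϖ1 : Valued.v ϖ ≤ 1 := hϖlt.le
  have hsh1 : Valued.v ϖ ^ (2 * (d - 1)) < 1 := pow_lt_one₀ zero_le hϖlt (by omega)
  -- an auxiliary unit-ball system `Rd'` modulo `|ϖ|^m` and its three filters
  obtain ⟨Rd', h1, h2, h3, -⟩ := exists_repr_fixedBall_card hσσ hvσ hfix hϖ hdd m 0
  simp only [mul_zero, pow_zero, add_zero] at h1 h2 h3
  set Ssh : Finset E := Rd'.filter fun W => Valued.v W = Valued.v ϖ ^ (2 * (d - 1)) with hSsh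
  set Sin : Finset E := Rd'.filter fun W => Valued.v W ≤ Valued.v ϖ ^ (2 * d) with hSin
  set Sball : Finset E := Rd'.filter fun W => Valued.v W ≤ Valued.v ϖ ^ (2 * (d - 1)) with hSball
  obtain ⟨hsh1', hsh2, hsh3⟩ := filter_level_repr (σ := σ) hϖ Rd' h1 h2 h3 (d - 1) (by omega)
  obtain ⟨hb1, hb2, hb3⟩ := filter_ball_repr (σ := σ) hϖ Rd' h1 h2 h3 (d - 1) (by omega)
  -- transfer `S ↦ Ssh` (class function, equal cardinalities)
  have hF : ∀ f ∈ {V : E | σ V = V ∧ Valued.v V = Valued.v ϖ ^ (2 * (d - 1))}, ∀ f' ∈ {V : E | σ V = V ∧ Valued.v V = Valued.v ϖ ^ (2 * (d - 1))},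
      Valued.v (f - f') ≤ Valued.v ϖ ^ m → normSign σ (1 + f) = normSign σ (1 + f') :=
    fun f hf f' hf' hff => normSign_oneAdd_eq_of_near hD (by omega) hf.1 (by rw [hf.2]; exact hsh1) hf'.1 hff
  have hsumS : ∑ W ∈ S, normSign σ (1 + W) = ∑ W ∈ Ssh, normSign σ (1 + W) :=
    sum_eq_sum_of_repr S Ssh (fun g hg => hS1 g hg) (fun f hf => hS2 f hf.1 hf.2) hS3 hsh1' hsh2 hsh3 (fun W => normSign σ (1 + W)) hF
  have hcardS : S.card = Ssh.card := card_eq_card_of_repr S Ssh (fun g hg => hS1 g hg) (fun f hf => hS2 f hf.1 hf.2) hS3 hsh1' hsh2 hsh3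
  -- the ball is the shell ⊔ the inner ball
  have hsplit : ∀ W ∈ Rd', (Valued.v W ≤ Valued.v ϖ ^ (2 * (d - 1)) ↔ (Valued.v W = Valued.v ϖ ^ (2 * (d - 1)) ∨ Valued.v W ≤ Valued.v ϖ ^ (2 * d))) := by
    intro W hW
    constructor
    · intro hle
      rcases eq_or_lt_of_le hle with h | h
      · exact Or.inl h
      · right
        have h' := v_le_pow_succ_succ_of_fixed_of_v_lt hfix hϖ (d - 1) (h1 W hW).1 h
        rwa [show 2 * (d - 1) + 2 = 2 * d by omega] at h'
    · rintro (h | h)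
      · exact h.le
      · exact h.trans (pow_le_pow_right_of_le_one' hϖ1 (by omega))
  have hunion : Sball = Ssh ∪ Sin := by
    ext W
    simp only [hSball, hSsh, hSin, mem_filter, mem_union]
    constructor
    · rintro ⟨hW, hle⟩
      rcases (hsplit W hW).1 hle with h | h
      · exact Or.inl ⟨hW, h⟩
      · exact Or.inr ⟨hW, h⟩
    · rintro (⟨hW, h⟩ | ⟨hW, h⟩)
      · exact ⟨hW, (hsplit W hW).2 (Or.inl h)⟩
      · exact ⟨hW, (hsplit W hW).2 (Or.inr h)⟩
  have hdisj : Disjoint Ssh Sin := by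
    rw [hSsh, hSin, disjoint_filter]
    intro W _ hEq hle
    have hlt : Valued.v ϖ ^ (2 * d) < Valued.v ϖ ^ (2 * (d - 1)) := pow_lt_pow_right_of_lt_one₀ (zero_lt_iff.2 hvϖ0) hϖlt (by omega)
    rw [hEq] at hle
    exact absurd hle (not_le.2 hlt)
  -- the ball sum vanishes (★ K6-(g) engine at `α₁ = γ₁ = 1`, `R = |ϖ|^{2(d−1)}`, `r = |ϖ|^m`)
  have hball : ∑ W ∈ Sball, normSign σ (1 + W) = 0 := by
    have h0 := sum_normSign_affine_ballSystem_eq_zero hD h2v (α₁ := 1) (γ₁ := 1) (map_one σ) (Valuation.map_one _) (map_one σ)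
      (R := Valued.v ϖ ^ (2 * (d - 1))) (r := Valued.v ϖ ^ m) ?_ ?_ (pow_ne_zero _ hvϖ0) ?_ Sball hb1 (fun V hσV hV => hb2 V ⟨hσV, hV⟩) hb3
    · simpa only [one_mul] using h0
    · rw [Valuation.map_one, one_mul]; exact hsh1
    · rw [Valuation.map_one, one_mul, v_varpi_pow hϖ, exp_le_exp]; push_cast; omega
    · rw [Valuation.map_one, one_mul]; exact pow_le_pow_right_of_le_one' hϖ1 (by omega)
  -- the inner ball contributes `+1` per class
  have hin : ∑ W ∈ Sin, normSign σ (1 + W) = (Sin.card : ℤ) := by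
    rw [sum_congr rfl (fun W hW => ?_), sum_const, nsmul_eq_mul, mul_one]
    obtain ⟨hWR, hWle⟩ := mem_filter.1 hW
    exact normSign_eq_one_of_fixed_of_v_sub_one_le hD (by rw [map_add, map_one, (h1 W hWR).1]) (n := 2 * d) (by omega) (by rwa [add_sub_cancel_left])
  -- cardinalities: `#shell = (q − 1)·#inner`
  have hcsh : Ssh.card = (Nat.card 𝓀[E] - 1) * Nat.card 𝓀[E] ^ ((m - 2 * (d - 1) + 1) / 2 - 1) := card_filter_level_eq hD Rd' h1 h2 h3 (d - 1) (by omega)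
  have hcin : Sin.card = Nat.card 𝓀[E] ^ ((m - 2 * d + 1) / 2) := card_filter_ball_eq hD Rd' h1 h2 h3 d hm
  have hexp : (m - 2 * (d - 1) + 1) / 2 - 1 = (m - 2 * d + 1) / 2 := by omega
  have hq1 : 1 ≤ Nat.card 𝓀[E] := Nat.card_pos
  have hcard : (Ssh.card : ℤ) = ((Nat.card 𝓀[E] : ℤ) - 1) * (Sin.card : ℤ) := by
    rw [hcsh, hcin, hexp]; push_cast [Nat.cast_sub hq1]; ring
  -- assemble
  have hshell : ∑ W ∈ Ssh, normSign σ (1 + W) = -(Sin.card : ℤ) := by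
    have h := hball
    rw [hunion, sum_union hdisj, hin] at h
    linarith
  rw [hsumS, hcardS, hshell, hcard]
  ring

/-- **THE CONDUCTOR SHELL SPLITS `(q − 2) : q`** (frame of `mul_sum_normSign_oneAdd_conductorShell`): `2(q−1)·#{W ∈ S : ω(1+W) = 1} = (q−2)·#S` and
`2(q−1)·#{W ∈ S : ω(1+W) ≠ 1} = q·#S`. [cite: Serre1979, Ch. V §3 Prop. 5, Cor. 2–3 pp. 84–86; Ch. XV §2] [cite: Flicker1998UnitaryFL, Prop. 7 p. 84] -/
theorem two_mul_card_filter_normSign_oneAdd_eq [CompleteSpace E] [Finite 𝓀[E]] (hD : IsRamifiedQuadraticDatum σ ϖ d tE) (h2v : Valued.v (2 : E) < 1) (hd : 2 ≤ d)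
    {m : ℕ} (hm : 2 * d ≤ m) (S : Finset E) (hS1 : ∀ W ∈ S, σ W = W ∧ Valued.v W = Valued.v ϖ ^ (2 * (d - 1)))
    (hS2 : ∀ W : E, σ W = W → Valued.v W = Valued.v ϖ ^ (2 * (d - 1)) → ∃ W₀ ∈ S, Valued.v (W - W₀) ≤ Valued.v ϖ ^ m)
    (hS3 : ∀ W ∈ S, ∀ W' ∈ S, Valued.v (W - W') ≤ Valued.v ϖ ^ m → W = W') :
    2 * ((Nat.card 𝓀[E] : ℤ) - 1) * ((S.filter fun W => normSign σ (1 + W) = 1).card : ℤ) = ((Nat.card 𝓀[E] : ℤ) - 2) * S.card ∧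
      2 * ((Nat.card 𝓀[E] : ℤ) - 1) * ((S.filter fun W => ¬ normSign σ (1 + W) = 1).card : ℤ) = (Nat.card 𝓀[E] : ℤ) * S.card := by
  have hmain := mul_sum_normSign_oneAdd_conductorShell hD h2v hd hm S hS1 hS2 hS3
  obtain ⟨hsum, hcard⟩ := sum_normSign_eq_card_sub_card (σ := σ) S (fun W => 1 + W)
  rw [hsum] at hmain
  constructor
  · linear_combination hmain + ((Nat.card 𝓀[E] : ℤ) - 1) * hcard
  · linear_combination -hmain + ((Nat.card 𝓀[E] : ℤ) - 1) * hcard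

/-! ## §2 The inversion `V ↦ A₀ ∕ V` of a digit shell -/

/-- **THE INVERSION OF A DIGIT SHELL.**  `|ϖ| = exp(−1)`, `σ` multiplicative (a ring hom); a unit-ball digit system `Rd` of `σ`-fixed integral elements modulo `|ϖ|^n` (`hRd1 hRd2 hRd3`);
a shell exponent `t` with `2t < n`; a `σ`-fixed `A₀` with `|A₀| = |ϖ|^{2a}`; exponents `s, m` with `t + s = a` and `m + 4t = n + 2a`.  THEN the image of the shell filter
`S_t := Rd.filter (|V| = |ϖ|^{2t})` under `V ↦ A₀ ∕ V` is a COMPLETE IRREDUNDANT system of representatives modulo `|ϖ|^m` of the fixed shell `{W : σW = W ∧ |W| = |ϖ|^{2s}}`, and the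
map is injective on `S_t` (`|A₀∕V − A₀∕V′|·|V|·|V′| = |A₀|·|V − V′|`). [cite: Serre1979, Ch. IV §2 Prop. 6] [cite: Flicker1998UnitaryFL, Prop. 7 p. 84] -/
theorem inversion_image_repr [DecidableEq E] (hϖ : Valued.v ϖ = exp (-1 : ℤ)) (Rd : Finset E) {n : ℕ}
    (hRd1 : ∀ V ∈ Rd, σ V = V ∧ Valued.v V ≤ 1)
    (hRd2 : ∀ V : E, σ V = V → Valued.v V ≤ 1 → ∃ V₀ ∈ Rd, Valued.v (V - V₀) ≤ Valued.v ϖ ^ n)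
    (hRd3 : ∀ V ∈ Rd, ∀ V' ∈ Rd, Valued.v (V - V') ≤ Valued.v ϖ ^ n → V = V')
    (t : ℕ) (ht : 2 * t < n) {A₀ : E} (hσA₀ : σ A₀ = A₀) {a : ℕ} (hA₀ : Valued.v A₀ = Valued.v ϖ ^ (2 * a))
    {s m : ℕ} (hs : t + s = a) (hmn : m + 4 * t = n + 2 * a) :
    (∀ W ∈ (Rd.filter fun V => Valued.v V = Valued.v ϖ ^ (2 * t)).image (fun V => A₀ / V), σ W = W ∧ Valued.v W = Valued.v ϖ ^ (2 * s)) ∧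
      (∀ W : E, σ W = W → Valued.v W = Valued.v ϖ ^ (2 * s) →
        ∃ W₀ ∈ (Rd.filter fun V => Valued.v V = Valued.v ϖ ^ (2 * t)).image (fun V => A₀ / V), Valued.v (W - W₀) ≤ Valued.v ϖ ^ m) ∧
      (∀ W ∈ (Rd.filter fun V => Valued.v V = Valued.v ϖ ^ (2 * t)).image (fun V => A₀ / V),
        ∀ W' ∈ (Rd.filter fun V => Valued.v V = Valued.v ϖ ^ (2 * t)).image (fun V => A₀ / V), Valued.v (W - W') ≤ Valued.v ϖ ^ m → W = W') ∧
      Set.InjOn (fun V : E => A₀ / V) ↑(Rd.filter fun V => Valued.v V = Valued.v ϖ ^ (2 * t)) := by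
  have hvϖ0 : Valued.v ϖ ≠ 0 := by rw [hϖ]; exact exp_ne_zero
  have hϖpos : 0 < Valued.v ϖ := zero_lt_iff.2 hvϖ0
  have hpow0 : ∀ k : ℕ, Valued.v ϖ ^ k ≠ 0 := fun k => pow_ne_zero _ hvϖ0
  have hA0 : A₀ ≠ 0 := fun h0 => by rw [h0, map_zero] at hA₀; exact hpow0 _ hA₀.symm
  obtain ⟨hl1, hl2, hl3⟩ := filter_level_repr (σ := σ) hϖ Rd hRd1 hRd2 hRd3 t ht
  set St : Finset E := Rd.filter fun V => Valued.v V = Valued.v ϖ ^ (2 * t) with hSt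
  -- members of the shell filter are non-zero of valuation `|ϖ|^{2t}`
  have hmem : ∀ V ∈ St, σ V = V ∧ Valued.v V = Valued.v ϖ ^ (2 * t) ∧ V ≠ 0 := fun V hV => by
    obtain ⟨hσV, hvV⟩ := hl1 V hV
    exact ⟨hσV, hvV, fun h0 => by rw [h0, map_zero] at hvV; exact hpow0 _ hvV.symm⟩
  -- the scaling identity
  have hscale : ∀ V V' : E, V ≠ 0 → V' ≠ 0 → Valued.v (A₀ / V - A₀ / V') * (Valued.v V * Valued.v V') = Valued.v A₀ * Valued.v (V - V') := by
    intro V V' hV hV'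
    rw [show A₀ / V - A₀ / V' = -(A₀ * (V - V')) / (V * V') by field_simp; ring, map_div₀, Valuation.map_neg, map_mul, map_mul,
      div_mul_cancel₀ _ (mul_ne_zero ((Valuation.ne_zero_iff _).2 hV) ((Valuation.ne_zero_iff _).2 hV'))]
  -- the value of an image point
  have hval : ∀ V : E, Valued.v V = Valued.v ϖ ^ (2 * t) → Valued.v (A₀ / V) = Valued.v ϖ ^ (2 * s) := fun V hvV => by
    rw [map_div₀, hA₀, hvV, div_eq_iff (hpow0 _), ← pow_add]; congr 1; omega
  have hinj : Set.InjOn (fun V : E => A₀ / V) ↑St := by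
    intro V hV V' hV' h
    obtain ⟨-, -, hV0⟩ := hmem V hV
    obtain ⟨-, -, hV'0⟩ := hmem V' hV'
    have h' : A₀ / V = A₀ / V' := h
    rw [div_eq_div_iff hV0 hV'0] at h'
    exact (mul_left_cancel₀ hA0 h').symm
  refine ⟨fun W hW => ?_, fun W hσW hvW => ?_, fun W hW W' hW' hWW => ?_, hinj⟩
  · obtain ⟨V, hV, rfl⟩ := mem_image.1 hW
    obtain ⟨hσV, hvV, -⟩ := hmem V hV
    exact ⟨by rw [map_div₀, hσA₀, hσV], hval V hvV⟩
  · -- completeness: invert `W`, represent, invert back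
    have hW0 : W ≠ 0 := fun h0 => by rw [h0, map_zero] at hvW; exact hpow0 _ hvW.symm
    have hvV : Valued.v (A₀ / W) = Valued.v ϖ ^ (2 * t) := by
      rw [map_div₀, hA₀, hvW, div_eq_iff (hpow0 _), ← pow_add]; congr 1; omega
    obtain ⟨V₀, hV₀, hnear⟩ := hl2 (A₀ / W) ⟨by rw [map_div₀, hσA₀, hσW], hvV⟩
    obtain ⟨-, hvV₀, hV₀0⟩ := hmem V₀ hV₀
    refine ⟨A₀ / V₀, mem_image.2 ⟨V₀, hV₀, rfl⟩, ?_⟩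
    have hAW0 : A₀ / W ≠ 0 := div_ne_zero hA0 hW0
    have key := hscale (A₀ / W) V₀ hAW0 hV₀0
    rw [div_div_cancel₀ hA0, hvV, hvV₀, hA₀] at key
    -- `|W − A₀∕V₀|·|ϖ|^{4t} = |ϖ|^{2a}·|A₀∕W − V₀| ≤ |ϖ|^{2a + n} = |ϖ|^m·|ϖ|^{4t}`
    have hineq : Valued.v (W - A₀ / V₀) * (Valued.v ϖ ^ (2 * t) * Valued.v ϖ ^ (2 * t)) ≤ Valued.v ϖ ^ m * (Valued.v ϖ ^ (2 * t) * Valued.v ϖ ^ (2 * t)) := by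
      rw [key]
      calc Valued.v ϖ ^ (2 * a) * Valued.v (A₀ / W - V₀) ≤ Valued.v ϖ ^ (2 * a) * Valued.v ϖ ^ n := mul_le_mul' le_rfl hnear
        _ = Valued.v ϖ ^ m * (Valued.v ϖ ^ (2 * t) * Valued.v ϖ ^ (2 * t)) := by
          rw [← pow_add, ← pow_add, ← pow_add]; congr 1; omega
    exact le_of_mul_le_mul_right hineq (mul_pos (pow_pos hϖpos _) (pow_pos hϖpos _))
  · obtain ⟨V, hV, rfl⟩ := mem_image.1 hW
    obtain ⟨V', hV', rfl⟩ := mem_image.1 hW'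
    obtain ⟨-, hvV, hV0⟩ := hmem V hV
    obtain ⟨-, hvV', hV'0⟩ := hmem V' hV'
    have key := hscale V V' hV0 hV'0
    rw [hvV, hvV', hA₀] at key
    -- `|ϖ|^{2a}·|V − V′| = |A₀∕V − A₀∕V′|·|ϖ|^{4t} ≤ |ϖ|^{m + 4t} = |ϖ|^{2a}·|ϖ|^n`
    have hineq : Valued.v ϖ ^ (2 * a) * Valued.v (V - V') ≤ Valued.v ϖ ^ (2 * a) * Valued.v ϖ ^ n := by
      rw [← key]
      calc Valued.v (A₀ / V - A₀ / V') * (Valued.v ϖ ^ (2 * t) * Valued.v ϖ ^ (2 * t))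
          ≤ Valued.v ϖ ^ m * (Valued.v ϖ ^ (2 * t) * Valued.v ϖ ^ (2 * t)) := mul_le_mul' hWW le_rfl
        _ = Valued.v ϖ ^ (2 * a) * Valued.v ϖ ^ n := by rw [← pow_add, ← pow_add, ← pow_add]; congr 1; omega
    have hVV : Valued.v (V - V') ≤ Valued.v ϖ ^ n := le_of_mul_le_mul_left hineq (pow_pos hϖpos _)
    rw [hl3 V hV V' hV' hVV]

/-! ## §3 HEAD-A — the boundary character count of a digit shell through the inversion -/

/-- **HEAD-A — «THE BOUNDARY CHARACTER COUNT OF A DIGIT SHELL».**  Wild datum on a complete `E` with finite residue field, `|2| < 1`, `2 ≤ d`; a unit-ball digit system `Rd` modulo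
`|ϖ|^n`; a shell `t`; a `σ`-fixed slope `A₀` with `|A₀| = |ϖ|^{2a}`, `a = t + (d − 1)` (so `A₀∕V` lies on the CONDUCTOR shell for `|V| = |ϖ|^{2t}`); the resolution floor
`2d + 4t ≤ n + 2a` (the inverted precision `n + 2a − 4t` reaches `2d`).  THEN
**`(q − 1) · Σ_{V ∈ Rd.filter (|V| = |ϖ|^{2t})} ω(1 + A₀∕V) = −#(Rd.filter (|V| = |ϖ|^{2t}))`** (§2 + §1 on the image + `Finset.sum_image`).
[cite: Serre1979, Ch. V §3 Prop. 5, Cor. 2–3 pp. 84–86; Ch. XV §2; Ch. IV §2 Prop. 6] [cite: Flicker1998UnitaryFL, Prop. 7 p. 84] [cite: Kottwitz1986BaseChangeUnits, §1 pp. 240–241] -/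
theorem mul_sum_normSign_oneAdd_div_shell [CompleteSpace E] [Finite 𝓀[E]] (hD : IsRamifiedQuadraticDatum σ ϖ d tE) (h2v : Valued.v (2 : E) < 1) (hd : 2 ≤ d)
    (Rd : Finset E) {n : ℕ} (hRd1 : ∀ V ∈ Rd, σ V = V ∧ Valued.v V ≤ 1)
    (hRd2 : ∀ V : E, σ V = V → Valued.v V ≤ 1 → ∃ V₀ ∈ Rd, Valued.v (V - V₀) ≤ Valued.v ϖ ^ n)
    (hRd3 : ∀ V ∈ Rd, ∀ V' ∈ Rd, Valued.v (V - V') ≤ Valued.v ϖ ^ n → V = V')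
    (t : ℕ) {A₀ : E} (hσA₀ : σ A₀ = A₀) {a : ℕ} (hA₀ : Valued.v A₀ = Valued.v ϖ ^ (2 * a)) (hat : a = t + (d - 1)) (hres : 2 * d + 4 * t ≤ n + 2 * a) :
    ((Nat.card 𝓀[E] : ℤ) - 1) * ∑ V ∈ Rd.filter (fun V => Valued.v V = Valued.v ϖ ^ (2 * t)), normSign σ (1 + A₀ / V) =
      -((Rd.filter fun V => Valued.v V = Valued.v ϖ ^ (2 * t)).card : ℤ) := by
  classical
  obtain ⟨-, -, hϖ, -, -, -, -⟩ := id hD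
  obtain ⟨h1, h2, h3, hinj⟩ := inversion_image_repr (σ := σ) hϖ Rd hRd1 hRd2 hRd3 t (by omega) hσA₀ hA₀ (s := d - 1) (m := n + 2 * a - 4 * t) (by omega) (by omega)
  have hcount := mul_sum_normSign_oneAdd_conductorShell hD h2v hd (m := n + 2 * a - 4 * t) (by omega) _ h1 h2 h3
  rwa [sum_image hinj, card_image_of_injOn hinj] at hcount

/-- **THE DIGIT SHELL SPLITS `(q − 2) : q` UNDER `V ↦ ω(1 + A₀∕V)`** (frame of `mul_sum_normSign_oneAdd_div_shell`): with `S_t := Rd.filter (|V| = |ϖ|^{2t})`,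
`2(q−1)·#{V ∈ S_t : ω(1 + A₀∕V) = 1} = (q−2)·#S_t` and `2(q−1)·#{V ∈ S_t : ω(1 + A₀∕V) ≠ 1} = q·#S_t` — the boundary-shell letters `2·L_H(d−1) = (q−2)·q^{d−2}·β`,
`2·L_A(d−1) = q^{d−1}·β` of ★ `…UniformDensityFromTables.crossDensity_of_tables` once `#S_t = (q−1)·q^{d−2}·β` (★ `…OneChartDigitTotals.card_filter_shell_eq_mul_card_ball`) and the class
conjuncts are read as `ω(1 + A₀∕V) = 1` ∕ `≠ 1` (FILE B). [cite: Serre1979, Ch. V §3 Prop. 5, Cor. 2–3 pp. 84–86; Ch. XV §2] [cite: Flicker1998UnitaryFL, Prop. 7 p. 84]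
[cite: Kottwitz1986BaseChangeUnits, §1 pp. 240–241] -/
theorem two_mul_card_filter_normSign_oneAdd_div_eq [CompleteSpace E] [Finite 𝓀[E]] (hD : IsRamifiedQuadraticDatum σ ϖ d tE) (h2v : Valued.v (2 : E) < 1) (hd : 2 ≤ d)
    (Rd : Finset E) {n : ℕ} (hRd1 : ∀ V ∈ Rd, σ V = V ∧ Valued.v V ≤ 1)
    (hRd2 : ∀ V : E, σ V = V → Valued.v V ≤ 1 → ∃ V₀ ∈ Rd, Valued.v (V - V₀) ≤ Valued.v ϖ ^ n)
    (hRd3 : ∀ V ∈ Rd, ∀ V' ∈ Rd, Valued.v (V - V') ≤ Valued.v ϖ ^ n → V = V')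
    (t : ℕ) {A₀ : E} (hσA₀ : σ A₀ = A₀) {a : ℕ} (hA₀ : Valued.v A₀ = Valued.v ϖ ^ (2 * a)) (hat : a = t + (d - 1)) (hres : 2 * d + 4 * t ≤ n + 2 * a) :
    2 * ((Nat.card 𝓀[E] : ℤ) - 1) * (((Rd.filter fun V => Valued.v V = Valued.v ϖ ^ (2 * t)).filter fun V => normSign σ (1 + A₀ / V) = 1).card : ℤ) =
        ((Nat.card 𝓀[E] : ℤ) - 2) * ((Rd.filter fun V => Valued.v V = Valued.v ϖ ^ (2 * t)).card : ℤ) ∧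
      2 * ((Nat.card 𝓀[E] : ℤ) - 1) * (((Rd.filter fun V => Valued.v V = Valued.v ϖ ^ (2 * t)).filter fun V => ¬ normSign σ (1 + A₀ / V) = 1).card : ℤ) =
        (Nat.card 𝓀[E] : ℤ) * ((Rd.filter fun V => Valued.v V = Valued.v ϖ ^ (2 * t)).card : ℤ) := by
  have hmain := mul_sum_normSign_oneAdd_div_shell hD h2v hd Rd hRd1 hRd2 hRd3 t hσA₀ hA₀ hat hres
  obtain ⟨hsum, hcard⟩ := sum_normSign_eq_card_sub_card (σ := σ) (Rd.filter fun V => Valued.v V = Valued.v ϖ ^ (2 * t)) (fun V => 1 + A₀ / V)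
  rw [hsum] at hmain
  constructor
  · linear_combination hmain + ((Nat.card 𝓀[E] : ℤ) - 1) * hcard
  · linear_combination -hmain + ((Nat.card 𝓀[E] : ℤ) - 1) * hcard

end Summit.HodgeConjecture.HodgeConjecture.Cruxes.H413.F0P3cDyRamConductorShellInversionCount

end
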